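import Summits.BirchSwinnertonDyer.Rank1Residual.F1Sign2.DefiniteMod2WaldspurgerReflectionAtTwo
import HarnessLib

/-!
# AN-43 / §30 kernel — -an g27's derivation (V) = (D0♯) at the (P)-transporter (crux workfile v9 714a99dc922491a4, `modTwoFixedPointValue_of_parts`, VERBATIM) for
# `F1Sign2/DefiniteMod2WaldspurgerReflectionAtTwo.lean` (typer -ty g20)

CONTENT (PROVED, no `sorry`, no new `def`): `modTwoFixedPointValue_of_parts : ModTwoToricReflectionCosetLaw → FixedPointTransporterOddDisc → ModTwoFixedPointValueOneModFour`
— REF1-AUDIT §261 A1: axioms = [propext, Classical.choice, Quot.sound]; the glue consumes every hypothesis of (V) ((D0♯) at the (P)-transporter, `𝔞 = 1`; `hx.act 1` = the class of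
`I` = the fixed point `x(y)` itself); R261e: «keep `modTwoFixedPointValue_of_parts` as the kernel glue».  BSD is not proved by this; 23715 is not closed by this.
-/

namespace Summit.BirchSwinnertonDyer.Rank1Residual.F1Sign2.ANg25.Kernel

open Literature.NumberTheory.Automorphic Literature.NumberTheory.Automorphic.Brandt
open Literature.NumberTheory.EllipticCurves
open Summit.BirchSwinnertonDyer.Rank1Residual.F1Sign2.ANg25

open scoped NumberField nonZeroDivisors Pointwise

/-- **Kernel-checked derivation (v9): (D0♯) + (P) ⟹ (V).**  Instantiate the reflection coset law at the transporter supplied by the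
position law and read it at `𝔞 = 1` (`1·1·[𝔡]⁻¹ ∈ H ⟺ [𝔡] ∈ H`). -/
theorem modTwoFixedPointValue_of_parts (hD : ModTwoToricReflectionCosetLaw) (hP : FixedPointTransporterOddDisc) :
    ModTwoFixedPointValueOneModFour := by
  intro W _ _ N hN h1 hcond hsurj hsq k _ _ hk hdk K _ _ d hK hdK hd hjac S _ φ ψ ψK I hx hy hφ hline c cK θ hc hcK hθ hanti
  obtain ⟨𝔡, α, hαI, hαψ, hnorm⟩ := hP N hN h1 k hk hdk K d hK hdK hd hjac S ψ ψK I hx hy c cK θ hc hcK hθ hanti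
  rcases hD W N hN hcond hsurj hsq k hk (Or.inr hdk) S φ ψ I hx hφ hline c 𝔡 α hc hαI hαψ with hzero | ⟨H, hH3, hfrob, hiff⟩
  · exact Or.inl hzero
  · refine Or.inr ⟨H, 𝔡, hH3, hfrob, hnorm, ?_⟩
    simpa using hiff 1

end Summit.BirchSwinnertonDyer.Rank1Residual.F1Sign2.ANg25.Kernel
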